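/-
Origin: expansion seat `planner-pub-hodgecm-mc-axioms-1-g14-0`, handover #W178 2026-08-20T15:53:55Z md5 a30b2373edca (PKG 4740f995e497 → a30b2373edca; 172 l.; MECHANICAL (iib-R) rewrite v3.1 of the PKG file as it stands (24 token edits; rules R1x1+RX[h₂']x23)) (`HOME/mc/pub-hodgecm-mc-axioms-1-g14/revendor/kit-r55/stage55/HodgeCM/Model/Sanity/DegenerateClosureOGEmpty.lean`, md5 a30b2373edca, 172 lines);
landed by the gen-22 packager (p-g22) in gate run 55 REPLACES the earlier landed copy of `HodgeCM/Model/Sanity/DegenerateClosureOGEmpty.lean` (seat copy carried the packager Origin header of an earlier run (stripped)).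
-/
/-
Origin: SANITY lane `planner-pub-hodgecm-mc-sanity-1-g12-0` (unit pub-hodgecm-mc-sanity-1-g12, gen 12 of mc-sanity-1,
node SAN-28), 2026-08-20.  NEW additive KERNEL leaf `HodgeCM/Model/Sanity/DegenerateClosureOGEmpty.lean` over two files
INSTALLED by RUN 43 — SAN-27 `HodgeCM.Model.Sanity.DegenerateClosureOGR21AEPI` (the degenerate closure of the E TERM OF
RECORD `Model.perL_picardCM_r21AEOGI` modulo its guarded data binder type `CdegSOG`) and SAN-26
`HodgeCM.Model.Sanity.DegenerateClosureOEmpty` (brings theta-3's (O2) `HodgeCM.Model.GoodSexticWitnessO` and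
`HodgeCM.Model.PerLInhabited`).  Imported by nothing.  KERNEL: 0 records, 0 definitions, 0 hypotheses minted, nothing
cited, no instances.  Expected `#print axioms`: ⊆ {propext, Classical.choice, Quot.sound}.
-/
import Summits.HodgeConjecture.HodgeCM.Model.Sanity.DegenerateClosureOGR21AEPI
import Summits.HodgeConjecture.HodgeCM.Model.Sanity.DegenerateClosureOEmpty

/-!
# SAN-28 — a good sextic context AT A CANONICAL EMBEDDING; the GUARDED residual of SAN-27 is REFUTED; `CdegSOG` is EMPTY

MODEL-CONSTRUCTION sub-cell, SANITY lane (unit `pub-hodgecm-mc-sanity-1-g12`, node SAN-28).  KERNEL only; census leaf.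

SAN-27 `perL_r21AEOGI_of_noCanonicalGoodSextic` closed the E TERM OF RECORD `Model.perL_picardCM_r21AEOGI` from the
degenerate data `S := degS`, `W := zeroSK ∘ W` EXACTLY modulo the GUARDED vacuity residual «no universe `(L, ι₁)` with
`ι₁` the canonical representative of its infinite place, `(NumberField.InfinitePlace.mk ι₁).embedding = ι₁`, carries an
anisotropic good sextic context for the model with bit `hb L ι₁`».  theta-3's (O2) `Model.exists_anisotropic_goodSexticO`
produces a good sextic context at SOME `ι₁` and does not control the representative.  This leaf supplies the missing
one-line strengthening from Mathlib's CM-field conjugation and nothing else: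

* `exists_embedding_mk_comp_eq` — for a CM field `L`, any `j : K →+* L` and any `ι : L →+* ℂ`, the canonical
  representative `(mk ι).embedding` (which is `ι` or `conjugate ι`, `NumberField.InfinitePlace.embedding_mk_eq`) agrees
  with `ι` on `K` along `j` or along `complexConj L ∘ j` (`NumberField.IsCMField.isConj_complexConj`): so it still
  extends the frame embedding `φ 0` of PerL's hypothesis class;
* `exists_goodSexticO_at` — the (O2) construction at a PRESCRIBED universe point: every `ι₁ : L →+* ℂ` extending `φ 0`
  along some `j` carries an anisotropic good sextic context of the model with bit `hb L ι₁` (body verbatim (O2));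
* `exists_anisotropic_goodSexticO_canonical` — hence an anisotropic good sextic context exists at a CANONICAL `ι₁`
  (`(mk ι₁).embedding = ι₁`, by `NumberField.InfinitePlace.mk_embedding`), for EVERY bit family `hb` and ALL data;
* `not_noCanonicalGoodSexticO_degS` — the guarded residual of SAN-27 (any `hb`, E's degenerate parameters) is FALSE;
* `isEmpty_CdegSOG` — SAN-27's guarded data binder type is EMPTY for every bit family (fibres empty over anisotropic
  contexts, SAN-10b, and a canonical anisotropic good sextic context exists); `isEmpty_CdegSOG_orientBitι` — in
  particular at the bit of record: the E TERM OF RECORD `perL_picardCM_r21AEOGI` can NOT be closed on degenerate data;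
  `isEmpty_CdegSO_of_G` recovers SAN-26 `isEmpty_CdegSO` by forgetting the guard.

READING (census, MODEL-N ±0; nothing about E is refuted — E's `C` reads the honest `S`, not `degS`): the degenerate
census of the term of record is now COMPLETE — over `S := degS`, `W := zeroSK ∘ W` every binder group but `C` is free
(SAN-27) and `C` = `CdegSOG` is UNINHABITED (this file); toy-visible groups 14 → 14.
-/

set_option autoImplicit false

noncomputable section

namespace HodgeCM
namespace Model
namespace Sanity

open HodgeCM.Universe (SideData ThetaModel AdelicThetaCore AdelicTorusCore)
open HodgeCM.PerL34 HodgeCM.PerL34.ArchC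
open Literature.AlgebraicGeometry.HodgeTheory Literature.NumberTheory.Automorphic.PicardCM
open Literature.NumberTheory.Transcendental (Arapura2012_Cor_15_4_6)
open Literature.AlgebraicGeometry.ShimuraVarieties
open Literature.AlgebraicGeometry.Motives (CMType)
open HodgeCM.Model.ThetaSpace
open HodgeCM.Model.SupplyResidual

variable (hHD : exists_isReal_hodgeModel) (hI : hodgePQ_independent_of_hodgeModel)
  (h₁ : BallQuotientUniformised)  (h₃ : CMAbelianVarietyRealised)

/-- For a CM field `L`, the CANONICAL representative `(mk ι).embedding` of the place of `ι : L →+* ℂ` agrees with `ι`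
on any `K` mapped into `L` — along `j` itself or along `complexConj L ∘ j` (Mathlib: `embedding_mk_eq`,
`IsCMField.isConj_complexConj`). -/
theorem exists_embedding_mk_comp_eq (L : CMField) {K : CMField} (j : K →+* L) (ι : L →+* ℂ) :
    ∃ j' : K →+* L, (NumberField.InfinitePlace.mk ι).embedding.comp j' = ι.comp j := by
  rcases NumberField.InfinitePlace.embedding_mk_eq ι with h | h
  · exact ⟨j, by rw [h]⟩
  · refine ⟨((NumberField.IsCMField.complexConj L :
      L ≃ₐ[↥(NumberField.maximalRealSubfield L)] L) : L →+* L).comp j, ?_⟩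
    rw [h]
    ext x
    simp [NumberField.ComplexEmbedding.conjugate_coe_eq]

/-- **The (O2) construction at a PRESCRIBED universe point.**  For ANY bit family `hb` and ANY data, every embedding
`ι₁ : L →+* ℂ` of a CM field `L` with `[L:ℚ] ∈ {24, 48}` that extends the frame embedding `φ 0` of a sextic `K` with
PerL types along some `j : K →+* L` carries an anisotropic good sextic context of `thetaModelOf … (hb L ι₁) …`
(proof = theta-3's `exists_anisotropic_goodSexticO`, with the universe point an argument instead of a witness). -/
theorem exists_goodSexticO_at (hb : ∀ L : CMField, (L →+* ℂ) → Bool) (emb) (cover) (wm) (Theta)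
    (d12 d34 : ∀ {L : CMField}, SeesawCtx L → SideData L)
    {K L : CMField} (hK : Module.finrank ℚ K = 6) (hL : Module.finrank ℚ L = 24 ∨ Module.finrank ℚ L = 48)
    (φ : Fin 3 → (K →+* ℂ)) (hφ : IsFrame φ) (t : Fin 4 → CMType K) (ht : IsPerLTypes φ t)
    (j : K →+* L) (ι₁ : L →+* ℂ) (hι₁ : ι₁.comp j = φ 0) :
    ∃ (V : HermSpace3 L ι₁) (c : SeesawCtx L),
      IsAnisotropic L V.Hm ∧ (thetaModelOf hHD hI h₁ h₃ (hb L ι₁) emb cover wm Theta d12 d34).GoodCtx ι₁ c ∧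
        Module.finrank ℚ c.K = 6 := by
  have hκ := (thetaModelOf hHD hI h₁ h₃ (hb L ι₁) emb cover wm Theta d12 d34).design_kappaConj_of_eq (hb L ι₁) rfl
  have hs := (thetaModelOf hHD hI h₁ h₃ (hb L ι₁) emb cover wm Theta d12 d34).design_frameSignConj_of_eq rfl
  have hΨ : PairSum t := StubTree.pairSum_of_isPerLTypes K φ hφ hK t ht
  obtain ⟨D, hD⟩ :=
    (thetaModelOf hHD hI h₁ h₃ (hb L ι₁) emb cover wm Theta d12 d34).exists_seesawDatum_constructed hκ hs j ι₁ t hΨ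
  obtain ⟨V⟩ := StubTree.landherr_exists L ι₁
  have h4 : 4 ≤ Module.finrank ℚ L := by rcases hL with hL | hL <;> omega
  exact ⟨V, ⟨K, t, φ 0, D⟩, V.isAnisotropic h4,
    ⟨hΨ, StubTree.injective_of_isPerLTypes K φ hφ t ht, fun i => (ht i 0).mpr (by fin_cases i <;> rfl),
      ⟨j, hι₁, hD⟩⟩, hK⟩

/-- **An anisotropic good sextic context exists at a CANONICAL embedding** `(NumberField.InfinitePlace.mk ι₁).embedding
= ι₁`, for EVERY oriented bit family `hb` and ALL data: PerL's hypothesis class (`perLHypothesesInhabited`) at the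
canonical representative of its `ι₁`, re-based along `j` or `complexConj ∘ j` (`exists_embedding_mk_comp_eq`). -/
theorem exists_anisotropic_goodSexticO_canonical (hb : ∀ L : CMField, (L →+* ℂ) → Bool) (emb) (cover) (wm) (Theta)
    (d12 d34 : ∀ {L : CMField}, SeesawCtx L → SideData L) :
    ∃ (L : CMField) (ι₁ : L →+* ℂ) (V : HermSpace3 L ι₁) (c : SeesawCtx L),
      IsAnisotropic L V.Hm ∧ (thetaModelOf hHD hI h₁ h₃ (hb L ι₁) emb cover wm Theta d12 d34).GoodCtx ι₁ c ∧
        Module.finrank ℚ c.K = 6 ∧ (NumberField.InfinitePlace.mk ι₁).embedding = ι₁ := by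
  obtain ⟨K, L, j₀, _hN, hK, hL, φ, hφ, ι₀, hι₀, t, ht⟩ := HodgeCM.perLHypothesesInhabited
  obtain ⟨j, hj⟩ := exists_embedding_mk_comp_eq L j₀ ι₀
  obtain ⟨V, c, hV, hc, h6⟩ :=
    exists_goodSexticO_at hHD hI h₁ h₃ hb emb cover wm Theta d12 d34 hK hL φ hφ t ht j _ (hj.trans hι₀)
  exact ⟨L, _, V, c, hV, hc, h6, by rw [NumberField.InfinitePlace.mk_embedding]⟩

/-- **No "no canonical good sextic context" for the ORIENTED family** (negation of SAN-27's guarded vacuity residual in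
its binder shape, for a general model datum). -/
theorem not_noCanonicalGoodSexticO (hb : ∀ L : CMField, (L →+* ℂ) → Bool) (emb) (cover) (wm) (Theta)
    (d12 d34 : ∀ {L : CMField}, SeesawCtx L → SideData L) :
    ¬ (∀ {L : CMField} {ι₁ : L →+* ℂ} (V : HermSpace3 L ι₁) (c : SeesawCtx L), IsAnisotropic L V.Hm →
        (thetaModelOf hHD hI h₁ h₃ (hb L ι₁) emb cover wm Theta d12 d34).GoodCtx ι₁ c →
        Module.finrank ℚ c.K = 6 → (NumberField.InfinitePlace.mk ι₁).embedding ≠ ι₁) := by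
  intro hno
  obtain ⟨L, ι₁, V, c, hV, hc, h6, hcan⟩ :=
    exists_anisotropic_goodSexticO_canonical hHD hI h₁ h₃ hb emb cover wm Theta d12 d34
  exact hno V c hV hc h6 hcan

/-- **The GUARDED vacuity residual of SAN-27 is FALSE** for every bit family `hb` and every `hA W μ` (E's degenerate
parameters `S := degS`, `W := zeroSK ∘ W`). -/
theorem not_noCanonicalGoodSexticO_degS (hb : ∀ L : CMField, (L →+* ℂ) → Bool) (hA : Arapura2012_Cor_15_4_6)
    (W : ∀ {L : CMField} {ι₁ : L →+* ℂ} (V : HermSpace3 L ι₁) (c : SeesawCtx L), WmInput V c.D)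
    (μ : ∀ {L : CMField}, SeesawCtx L → Fin 4 → NumberField.InfinitePlace L → ℤ) :
    ¬ (∀ {L : CMField} {ι₁ : L →+* ℂ} (V : HermSpace3 L ι₁) (c : SeesawCtx L), IsAnisotropic L V.Hm →
        (thetaModelOf hHD hI h₁ h₃ (hb L ι₁) (embOf hHD hI h₁ h₃) (coverOf hHD hI h₁ h₃ hA)
          (wmOfInput fun V c => (W V c).zeroSK)
          (thetaOf _ (thetaClassInputOf _ (fun V c => thetaSpaceInputOf hHD hI h₁ h₃ degS V c))) (d12Of μ)
          (d34Of μ)).GoodCtx ι₁ c →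
        Module.finrank ℚ c.K = 6 → (NumberField.InfinitePlace.mk ι₁).embedding ≠ ι₁) :=
  not_noCanonicalGoodSexticO hHD hI h₁ h₃ hb (embOf hHD hI h₁ h₃) (coverOf hHD hI h₁ h₃ hA)
    (wmOfInput fun V c => (W V c).zeroSK)
    (thetaOf _ (thetaClassInputOf _ (fun V c => thetaSpaceInputOf hHD hI h₁ h₃ degS V c))) (d12Of μ) (d34Of μ)

/-- **`CdegSOG` is EMPTY** for every bit family: the guarded oriented E cannot be closed on degenerate data. -/
theorem isEmpty_CdegSOG (hb : ∀ L : CMField, (L →+* ℂ) → Bool) (hA : Arapura2012_Cor_15_4_6)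
    (W : ∀ {L : CMField} {ι₁ : L →+* ℂ} (V : HermSpace3 L ι₁) (c : SeesawCtx L), WmInput V c.D)
    (μ : ∀ {L : CMField}, SeesawCtx L → Fin 4 → NumberField.InfinitePlace L → ℤ) :
    IsEmpty (CdegSOG hHD hI h₁ h₃ hb hA W μ) :=
  ⟨fun C => not_noCanonicalGoodSexticO_degS hHD hI h₁ h₃ hb hA W μ fun V c hV hc h6 hcan =>
    (isEmpty_C_fibre_degS hHD hI h₁ h₃ V c hV).false (C V c hV hc h6 hcan)⟩

/-- **The data binder type of the E TERM OF RECORD over the degenerate data is EMPTY**: `CdegSOG` at the bit of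
record `orientBitι` — the hypothesis `C` of SAN-27 `perL_r21AEOGI_degS` is uninhabited. -/
theorem isEmpty_CdegSOG_orientBitι (hA : Arapura2012_Cor_15_4_6)
    (W : ∀ {L : CMField} {ι₁ : L →+* ℂ} (V : HermSpace3 L ι₁) (c : SeesawCtx L), WmInput V c.D)
    (μ : ∀ {L : CMField}, SeesawCtx L → Fin 4 → NumberField.InfinitePlace L → ℤ) :
    IsEmpty (CdegSOG hHD hI h₁ h₃ orientBitι hA W μ) :=
  isEmpty_CdegSOG hHD hI h₁ h₃ orientBitι hA W μ

/-- Forgetting the guard: SAN-26 `isEmpty_CdegSO` again, from the stronger guarded emptiness. -/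
theorem isEmpty_CdegSO_of_G (hb : ∀ L : CMField, (L →+* ℂ) → Bool) (hA : Arapura2012_Cor_15_4_6)
    (W : ∀ {L : CMField} {ι₁ : L →+* ℂ} (V : HermSpace3 L ι₁) (c : SeesawCtx L), WmInput V c.D)
    (μ : ∀ {L : CMField}, SeesawCtx L → Fin 4 → NumberField.InfinitePlace L → ℤ) :
    IsEmpty (CdegSO hHD hI h₁ h₃ hb hA W μ) :=
  ⟨fun C => (isEmpty_CdegSOG hHD hI h₁ h₃ hb hA W μ).false fun V c hV hc h6 _ => C V c hV hc h6⟩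

end Sanity
end Model
end HodgeCM

end
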